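import Summits.QuantumFields.QCD.Theorems.QuarksAsStableActionStableActionBridgeStubOffDiagonalTensorDensity
import HarnessLib

/-!
# Separated real tensors are total in `⁰𝒮((ℝ⁴)ⁿ)`

Helper file for stub `stub_separatedTensorsTotal` of crux `CurvatureAmnesia`
(item stmt-QuantumFields-16192, line `WardDefectSketch`): pure Schwartz-space analysis.

Two continuous linear functionals `T₁, T₂` on `𝓢(((ℝ⁴)ⁿ), ℂ)` that agree on every complexified REAL tensor
`f₁ ⊗ ⋯ ⊗ fₙ` whose factors `fᵢ ∈ 𝓢(ℝ⁴, ℝ)` have compact and pairwise disjoint supports (a SEPARATED family)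
agree on every `F ∈ ⁰𝒮((ℝ⁴)ⁿ)` (`IsOffDiagonal F`: `F` vanishes with all derivatives on the coincidence locus).
Route (the `⁰𝒮` form of `𝒮(ℝ^{4n}) = ⊗̂ⁿ 𝒮(ℝ⁴)`, OS 1973 §2), adapted from the landed QCD density theorem
`Summit.QuantumFields.QCD.Cruxes.StableActionBridge.Sketch.stub_offDiagonalTensorDensity` with the target set
"off-diagonal real tensor products" replaced by "real tensors with compactly supported, pairwise disjoint factors":

1. `F` is the Schwartz limit of compactly supported `u_m` supported at pairwise distances `≥ δ_m > 0`
   (`exists_separated_tendsto_of_isOffDiagonal`); it suffices to put one such `u` in the closed span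
   (`sep_mem_closure_of_separated`).
2. The lattice partition of unity of `SchwartzPartition` at mesh `δ / 24` converges on Schwartz space
   (`tendsto_latticeWindow_smul`), so it suffices to treat one piece `η_β u` (`sep_piece_mem_closure`).
3. A non-zero piece is supported in a closed box containing a point of `supp u`, whose particle coordinates are
   pairwise `≥ δ > 12 h` apart, whence the OUTER per-particle blocks are pairwise disjoint; the box engine
   `mem_closure_span_boxTensors` puts the piece in the closed span of the real tensors with factors supported
   in these blocks, and such factors have compact (a block is bounded) and pairwise disjoint supports
   (`sep_boxTensors_subset`).
4. `T₁ = T₂` on the set, hence on the closure of its span (`ContinuousLinearMap.eqOn_closure_span`).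

Refs: K. Osterwalder, R. Schrader, Comm. Math. Phys. 31 (1973) 83–112, §2 (the spaces `⁰𝒮`, `⊗̂ⁿ 𝒮`);
the Fourier-series/partition-of-unity proof is textbook folklore.
-/

noncomputable section

open scoped SchwartzMap
open Filter Topology Set
open Literature.MathematicalPhysics.QuantumLattice Literature.MathematicalPhysics.AQFT
open Summit.QuantumFields.YangMills.Cruxes.OSLegsAtWeakCouplingC.Sketch (Separated
  exists_separated_tendsto_of_isOffDiagonal)

namespace Summit.QuantumFields.YangMills.Cruxes.CurvatureAmnesia.WardDefect

/-- **Box tensors over pairwise disjoint blocks are separated real tensors.**  If the outer per-particle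
blocks `{x | ∀ c, Λ(x)_c ∈ (l_{ic}, u_{ic})}` of `B : BoxData n m` are pairwise disjoint, every element of
`B.boxTensors Λ` (a tensor `g₁ ⊗ ⋯ ⊗ gₙ` of real test functions with `supp gᵢ ⊆ block i`) is a real tensor whose
factors have compact supports (`supp gᵢ` is closed and lies in the compact box `Λ⁻¹(∏_c [l_{ic}, u_{ic}])`) and
pairwise disjoint supports (`supp gᵢ ⊆ block i`). [folklore] -/
theorem sep_boxTensors_subset {E : Type*} [NormedAddCommGroup E] [NormedSpace ℝ E] {n m : ℕ}
    (Λ : E ≃L[ℝ] EuclideanSpace ℝ (Fin m)) (B : BoxData n m)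
    (hdisj : ∀ i j : Fin n, i ≠ j →
      Disjoint {x : E | ∀ c, (Λ x) c ∈ Ioo (B.l (i, c)) (B.u (i, c))}
        {x : E | ∀ c, (Λ x) c ∈ Ioo (B.l (j, c)) (B.u (j, c))}) :
    B.boxTensors Λ ⊆ {G : 𝓢((Fin n → E), ℂ) | ∃ g : Fin n → 𝓢(E, ℝ),
      (∀ i, HasCompactSupport (g i : E → ℝ)) ∧
        (∀ i j, i ≠ j → Disjoint (tsupport (g i : E → ℝ)) (tsupport (g j : E → ℝ))) ∧
          IsTensorOf G (fun i => ofRealTest (g i))} := by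
  -- adapted from `StableActionBridge.Sketch.offDiag_boxTensors_subset`
  rintro P ⟨g, hg, hP⟩
  refine ⟨g, fun i => ?_, fun i j hij => (hdisj i j hij).mono (hg i) (hg j), hP⟩
  -- the closed coordinate box `Λ⁻¹(∏_c [l_{ic}, u_{ic}])` is compact
  have hK : IsCompact ((Λ.trans (EuclideanSpace.equiv (Fin m) ℝ)).toHomeomorph ⁻¹'
      Set.pi Set.univ fun c => Icc (B.l (i, c)) (B.u (i, c))) :=
    (Homeomorph.isCompact_preimage _).2 (isCompact_univ_pi fun _ => isCompact_Icc)
  exact IsCompact.of_isClosed_subset hK (isClosed_tsupport _)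
    ((hg i).trans fun x hx => Set.mem_univ_pi.2 fun c => Ioo_subset_Icc_self (hx c))

/-- **One piece of the lattice partition of a separated test function lies in the closed span of the separated
real tensors.**  For `u` supported at pairwise particle distances `≥ δ` (`tsupport u ⊆ Separated n δ`), `0 < h`,
`12 h < δ` and `β ∈ ℤ^{4n}`, the piece `η_β · u` (`η_β` the lattice bump of `SchwartzPartition` in the mesh
coordinates at scale `h`) belongs to the closure of the span of the real tensors with compactly supported,
pairwise disjoint factors: it is supported in the closed box `∏ [(β_{ic} - 1) h, (β_{ic} + 1) h]`; unless it
vanishes this box contains a point `v` with `dist (v i) (v j) ≥ δ` (`i ≠ j`), so the outer blocks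
`∏_c ((β_{ic} - 2) h, (β_{ic} + 2) h)` are pairwise disjoint (two points of blocks `i`, `j` with a common value
force `dist (v i) (v j) ≤ √4 · 6 h = 12 h < δ`); conclude by the box engine `mem_closure_span_boxTensors` and
`sep_boxTensors_subset`. [folklore] -/
theorem sep_piece_mem_closure {n : ℕ} {u : 𝓢((Fin n → EuclideanSpace ℝ (Fin 4)), ℂ)} {δ h : ℝ}
    (hu : tsupport (u : (Fin n → EuclideanSpace ℝ (Fin 4)) → ℂ) ⊆ Separated n δ) (hh : 0 < h)
    (hhδ : 12 * h < δ) (β : Fin (n * 4) → ℤ) :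
    SchwartzMap.smulLeftCLM ℂ (fun y => ((latticeBump (meshCoord n 4 h hh) β y : ℝ) : ℂ)) u ∈
      closure ((Submodule.span ℂ
        {G : 𝓢((Fin n → EuclideanSpace ℝ (Fin 4)), ℂ) | ∃ g : Fin n → 𝓢(EuclideanSpace ℝ (Fin 4), ℝ),
          (∀ i, HasCompactSupport (g i : EuclideanSpace ℝ (Fin 4) → ℝ)) ∧
            (∀ i j, i ≠ j → Disjoint (tsupport (g i : EuclideanSpace ℝ (Fin 4) → ℝ))
              (tsupport (g j : EuclideanSpace ℝ (Fin 4) → ℝ))) ∧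
              IsTensorOf G (fun i => ofRealTest (g i))} :
          Submodule ℂ 𝓢((Fin n → EuclideanSpace ℝ (Fin 4)), ℂ)) :
        Set 𝓢((Fin n → EuclideanSpace ℝ (Fin 4)), ℂ)) := by
  -- adapted from `StableActionBridge.Sketch.offDiag_piece_mem_closure`
  -- (itself from `IsTimeOrdered.smulLeftCLM_latticeBump_translate_mem_closure`, `SchwartzOrderedWedgeDensity`)
  set G := SchwartzMap.smulLeftCLM ℂ (fun y => ((latticeBump (meshCoord n 4 h hh) β y : ℝ) : ℂ)) u
    with hG
  -- the box of `β` in the coordinates `v_i^c`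
  obtain ⟨b, hb⟩ : ∃ b : Fin n × Fin 4 → ℝ, ∀ ic, b ic = ((β (finProdFinEquiv ic) : ℤ) : ℝ) :=
    ⟨_, fun _ => rfl⟩
  have hbox : ∀ v ∈ tsupport (G : (Fin n → EuclideanSpace ℝ (Fin 4)) → ℂ), ∀ ic : Fin n × Fin 4,
      b ic * h - h ≤ v ic.1 ic.2 ∧ v ic.1 ic.2 ≤ b ic * h + h := by
    intro v hv ic
    have h1 := (SchwartzMap.tsupport_smulLeftCLM_subset (F := ℂ) _ u hv).2
    rw [tsupport_latticeBumpC (meshCoord n 4 h hh) β] at h1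
    have h2 := tsupport_latticeBump_subset (meshCoord n 4 h hh) β h1 (finProdFinEquiv ic)
    rw [meshCoord_apply, mem_Icc, ← hb ic] at h2
    constructor
    · have h3 : b ic - 1 ≤ v ic.1 ic.2 / h := by linarith [h2.1]
      rw [le_div_iff₀ hh] at h3
      linarith
    · have h3 : v ic.1 ic.2 / h ≤ b ic + 1 := by linarith [h2.2]
      rw [div_le_iff₀ hh] at h3
      linarith
  -- the zero piece
  by_cases hG0 : G = 0
  · rw [hG0]
    exact subset_closure (Submodule.zero_mem _)
  -- otherwise a point of the support of `u` lies in the box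
  obtain ⟨v, hv⟩ : ∃ v, G v ≠ 0 := by
    by_contra hcon
    push Not at hcon
    exact hG0 (SchwartzMap.ext hcon)
  have hvbox := hbox v (subset_tsupport _ hv)
  have huv : u v ≠ 0 := by
    rw [hG, SchwartzMap.smulLeftCLM_apply_apply
      (hasTemperateGrowth_latticeBumpC (meshCoord n 4 h hh) β)] at hv
    exact right_ne_zero_of_smul hv
  have hsep : ∀ i j : Fin n, i ≠ j → δ ≤ dist (v i) (v j) := hu (subset_tsupport _ huv)
  -- the nested boxes
  let B : BoxData n 4 :=
    { l := fun ic => b ic * h - 2 * h, u := fun ic => b ic * h + 2 * h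
      l' := fun ic => b ic * h - h, u' := fun ic => b ic * h + h
      hl := fun ic => by linarith, hl' := fun ic => by linarith, hu := fun ic => by linarith }
  let Λ₀ : EuclideanSpace ℝ (Fin 4) ≃L[ℝ] EuclideanSpace ℝ (Fin 4) := ContinuousLinearEquiv.refl ℝ _
  have hF' : tsupport (G : (Fin n → EuclideanSpace ℝ (Fin 4)) → ℂ) ⊆
      {v | ∀ ic : Fin n × Fin 4, (Λ₀ (v ic.1)) ic.2 ∈ Icc (B.l' ic) (B.u' ic)} :=
    fun v hv ic => hbox v hv ic
  -- the outer blocks are pairwise disjoint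
  have hdisj : ∀ i j : Fin n, i ≠ j →
      Disjoint {x : EuclideanSpace ℝ (Fin 4) | ∀ c, (Λ₀ x) c ∈ Ioo (B.l (i, c)) (B.u (i, c))}
        {x : EuclideanSpace ℝ (Fin 4) | ∀ c, (Λ₀ x) c ∈ Ioo (B.l (j, c)) (B.u (j, c))} := by
    intro i j hij
    refine Set.disjoint_left.2 fun y hyi hyj => ?_
    have hc : ∀ c, |(v i - v j) c| ≤ 6 * h := fun c => by
      have h1 : b (i, c) * h - 2 * h < y c ∧ y c < b (i, c) * h + 2 * h := hyi c
      have h2 : b (j, c) * h - 2 * h < y c ∧ y c < b (j, c) * h + 2 * h := hyj c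
      have h3 := hvbox (i, c)
      have h4 := hvbox (j, c)
      dsimp only at h3 h4
      rw [PiLp.sub_apply, abs_le]
      constructor <;> linarith [h1.1, h1.2, h2.1, h2.2, h3.1, h3.2, h4.1, h4.2]
    have hdist : dist (v i) (v j) ≤ 12 * h := by
      have h0 := EuclideanSpace.norm_le_sqrt_card_mul (v i - v j) (by positivity : (0 : ℝ) ≤ 6 * h) hc
      rw [Fintype.card_fin, show ((4 : ℕ) : ℝ) = 2 ^ 2 by norm_num, Real.sqrt_sq (by norm_num)] at h0
      rw [dist_eq_norm]
      linarith
    have h5 := hsep i j hij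
    linarith
  exact closure_mono (Submodule.span_mono (sep_boxTensors_subset Λ₀ B hdisj))
    (mem_closure_span_boxTensors Λ₀ B G hF')

/-- **A separated test function lies in the closed span of the separated real tensors.**  If
`tsupport u ⊆ Separated n δ` with `δ > 0`, then `u` is in the closure of the span of the real tensors with
compactly supported, pairwise disjoint factors: the lattice partition of unity at mesh `δ / 24` converges on
Schwartz space, `∑_{β ∈ [-R, R]^{4n}} η_β u = W_R u → u` (`tendsto_latticeWindow_smul`), and every piece `η_β u`
lies in the closed span (`sep_piece_mem_closure`), which is a closed submodule. [folklore] -/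
theorem sep_mem_closure_of_separated {n : ℕ} {u : 𝓢((Fin n → EuclideanSpace ℝ (Fin 4)), ℂ)} {δ : ℝ}
    (hδ : 0 < δ) (hu : tsupport (u : (Fin n → EuclideanSpace ℝ (Fin 4)) → ℂ) ⊆ Separated n δ) :
    u ∈ closure ((Submodule.span ℂ
        {G : 𝓢((Fin n → EuclideanSpace ℝ (Fin 4)), ℂ) | ∃ g : Fin n → 𝓢(EuclideanSpace ℝ (Fin 4), ℝ),
          (∀ i, HasCompactSupport (g i : EuclideanSpace ℝ (Fin 4) → ℝ)) ∧
            (∀ i j, i ≠ j → Disjoint (tsupport (g i : EuclideanSpace ℝ (Fin 4) → ℝ))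
              (tsupport (g j : EuclideanSpace ℝ (Fin 4) → ℝ))) ∧
              IsTensorOf G (fun i => ofRealTest (g i))} :
          Submodule ℂ 𝓢((Fin n → EuclideanSpace ℝ (Fin 4)), ℂ)) :
        Set 𝓢((Fin n → EuclideanSpace ℝ (Fin 4)), ℂ)) := by
  -- adapted from `StableActionBridge.Sketch.offDiag_mem_closure_of_separated`
  -- (itself from `IsTimeOrdered.mem_closure_span_slabOrderedProducts`, `SchwartzOrderedWedgeDensity`)
  set S : Submodule ℂ 𝓢((Fin n → EuclideanSpace ℝ (Fin 4)), ℂ) := Submodule.span ℂ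
    {G : 𝓢((Fin n → EuclideanSpace ℝ (Fin 4)), ℂ) | ∃ g : Fin n → 𝓢(EuclideanSpace ℝ (Fin 4), ℝ),
      (∀ i, HasCompactSupport (g i : EuclideanSpace ℝ (Fin 4) → ℝ)) ∧
        (∀ i j, i ≠ j → Disjoint (tsupport (g i : EuclideanSpace ℝ (Fin 4) → ℝ))
          (tsupport (g j : EuclideanSpace ℝ (Fin 4) → ℝ))) ∧
          IsTensorOf G (fun i => ofRealTest (g i))} with hS
  have hC : IsClosed (closure (S : Set 𝓢((Fin n → EuclideanSpace ℝ (Fin 4)), ℂ))) := isClosed_closure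
  have hh : (0 : ℝ) < δ / 24 := by positivity
  set Λ := meshCoord n 4 (δ / 24) hh
  -- the lattice partition of unity at mesh `δ / 24`: `∑_β η_β · u = W_R · u → u`
  have hlim : Tendsto (fun R : ℕ => ∑ β ∈ latticeCube (n * 4) R,
      SchwartzMap.smulLeftCLM ℂ (fun y => ((latticeBump Λ β y : ℝ) : ℂ)) u) atTop (𝓝 u) := by
    have hsum : ∀ R : ℕ, ∑ β ∈ latticeCube (n * 4) R,
        SchwartzMap.smulLeftCLM ℂ (fun y => ((latticeBump Λ β y : ℝ) : ℂ)) u =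
          SchwartzMap.smulLeftCLM ℂ (fun y => ((latticeWindow Λ R y : ℝ) : ℂ)) u := by
      intro R
      have hW : (fun y => ((latticeWindow Λ R y : ℝ) : ℂ)) =
          fun y => ∑ β ∈ latticeCube (n * 4) R, ((latticeBump Λ β y : ℝ) : ℂ) := by
        funext y
        rw [← sum_latticeCube_latticeBump Λ R y, Complex.ofReal_sum]
      rw [hW, SchwartzMap.smulLeftCLM_sum fun β _ => hasTemperateGrowth_latticeBumpC Λ β,
        FunLike.coe_sum, Finset.sum_apply]
    simp_rw [hsum]
    exact tendsto_latticeWindow_smul Λ ℂ u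
  refine hC.mem_of_tendsto hlim (Eventually.of_forall fun R => ?_)
  -- every piece lies in the closed span
  exact S.topologicalClosure.sum_mem fun β _ => sep_piece_mem_closure hu hh (by linarith) β

/-- **Separated real tensors are total in `⁰𝒮((ℝ⁴)ⁿ)`** (stub `stub_separatedTensorsTotal` of line
`WardDefectSketch`; the expanded form of `SeparatedTensorsTotal`, verbatim the registered S2 of `Lines/birth.lean`).
Two continuous linear functionals on `𝓢(((ℝ⁴)ⁿ), ℂ)` agreeing on the complexified real tensors `f₁ ⊗ ⋯ ⊗ fₙ` with
compactly supported, pairwise disjoint factors agree on every test function flat on the coincidence locus.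
Proof: every `F ∈ ⁰𝒮` is the Schwartz limit of compactly supported cutoffs supported at pairwise distances
`≥ δ_m > 0` (`exists_separated_tendsto_of_isOffDiagonal`), each of which lies in the closed span of the separated
real tensors (`sep_mem_closure_of_separated`: lattice partition of unity at mesh `δ_m / 24` and the box
Fourier-series engine `mem_closure_span_boxTensors` over pairwise disjoint bounded blocks); two continuous linear
functionals agreeing on a set agree on the closure of its span (`ContinuousLinearMap.eqOn_closure_span`).  The
`⁰𝒮` form of `𝒮(ℝ^{4n}) = ⊗̂ⁿ 𝒮(ℝ⁴)` (OS 1973 §2). -/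
theorem stub_separatedTensorsTotal :
    ∀ (n : ℕ) (T₁ T₂ : 𝓢((Fin n → EuclideanSpace ℝ (Fin 4)), ℂ) →L[ℂ] ℂ),
      (∀ f : Fin n → 𝓢(EuclideanSpace ℝ (Fin 4), ℝ),
        ((∀ i, HasCompactSupport (f i : EuclideanSpace ℝ (Fin 4) → ℝ)) ∧
          ∀ i j, i ≠ j → Disjoint (tsupport (f i : EuclideanSpace ℝ (Fin 4) → ℝ))
            (tsupport (f j : EuclideanSpace ℝ (Fin 4) → ℝ))) →
        ∀ F : 𝓢((Fin n → EuclideanSpace ℝ (Fin 4)), ℂ), IsTensorOf F (fun i => ofRealTest (f i)) →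
          T₁ F = T₂ F) →
      ∀ F : 𝓢((Fin n → EuclideanSpace ℝ (Fin 4)), ℂ), IsOffDiagonal F → T₁ F = T₂ F := by
  intro n T₁ T₂ hT F hF
  -- `F` lies in the closed span of the separated real tensors
  have hmem : F ∈ closure ((Submodule.span ℂ
      {G : 𝓢((Fin n → EuclideanSpace ℝ (Fin 4)), ℂ) | ∃ g : Fin n → 𝓢(EuclideanSpace ℝ (Fin 4), ℝ),
        (∀ i, HasCompactSupport (g i : EuclideanSpace ℝ (Fin 4) → ℝ)) ∧
          (∀ i j, i ≠ j → Disjoint (tsupport (g i : EuclideanSpace ℝ (Fin 4) → ℝ))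
            (tsupport (g j : EuclideanSpace ℝ (Fin 4) → ℝ))) ∧
            IsTensorOf G (fun i => ofRealTest (g i))} :
        Submodule ℂ 𝓢((Fin n → EuclideanSpace ℝ (Fin 4)), ℂ)) :
      Set 𝓢((Fin n → EuclideanSpace ℝ (Fin 4)), ℂ)) := by
    obtain ⟨u, -, hsep, hlim⟩ := exists_separated_tendsto_of_isOffDiagonal F hF
    refine isClosed_closure.mem_of_tendsto hlim (Eventually.of_forall fun m => ?_)
    obtain ⟨δ, hδ, hδsupp⟩ := hsep m
    exact sep_mem_closure_of_separated hδ hδsupp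
  -- `T₁ = T₂` on the separated real tensors, hence on the closure of their span
  refine ContinuousLinearMap.eqOn_closure_span (fun G hG => ?_) hmem
  obtain ⟨g, hgc, hgd, hG'⟩ := hG
  exact hT g ⟨hgc, hgd⟩ G hG'

end Summit.QuantumFields.YangMills.Cruxes.CurvatureAmnesia.WardDefect

end
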